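import Mathlib
import Summits.ResolutionOfSingularities.ResolutionOfSingularities.Theorems.WeightedInvariantLocalWeightedDropNCBranchPrimesSwap
import Summits.ResolutionOfSingularities.ResolutionOfSingularities.Theorems.WeightedInvariantLocalWeightedDropNCResPresentationDefs
import Summits.ResolutionOfSingularities.ResolutionOfSingularities.Theorems.WeightedInvariantLocalWeightedDropTrackCMonomialDivisor

/-!
# `LocalWeightedDrop`, TOT2-LINE regime (P), piece (β-prime) — UNDER THE PRESENTATION CONTEXT: a presented regime label has a squarefree germ, so
# its prime / u₁-graph / u₂-graph index sets are finite

Crux item stmt-ResolutionOfSingularities-8899 `WeightedInvariant.LocalWeightedDrop` (route `ResolutionOfSingularities/WeightedInvariant`), ENGINE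
skeleton v34 (80c4710965b6845c), registered stub `stub_regimePresented`, piece (P3): the conflict budget `M d A N` of
`TameFourTupleDrop.regimePresented_of_pieces` (…NCResRegimePresentedAssembly, p547539) is only ever evaluated under the CONTEXT HYPOTHESIS
`∃ b δ Θ, Admissible b δ ∧ 2 ≤ δ.o ∧ δ.c = d ∧ δ.PresBy d A N Θ` of its laws `hM_succ` / `hM_conf`.  This file derives from that context exactly
the two inputs of the (β-prime) finiteness theorems — `2 ≤ d` and `Squarefree (NCPoly.monicGerm d A)` — and restates the finiteness of the three
index sets under it.  [OURS · L1 W4.3 · chain w43 · seat res-L1-w43-stub-1 gen 6; def-free; `…NCBranchPrimesFinite/Reading/Swap` + `TrackC.prime_X`;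
nothing here is a statement of any manuscript; AI-produced, gate-checked, weaker than expert review.]

* `not_X_dvd_X`, `squarefree_mul_prod_X` — `f · ∏_{l ∈ S} X_l` is squarefree when `f` is and no `X_l`, `l ∈ S`, divides `f`;
* `squarefree_subst_of_isCountMove` — a count move's coordinate change (legal: zero constant terms, invertible linear part) preserves
  squarefreeness (`NCBranchPrimes.exists_inverse_ringHom` + `squarefree_map_of_inverse`);
* **`squarefree_monicGerm_of_presBy`** — `Admissible b δ → δ.PresBy d A N Θ → Squarefree (NCPoly.monicGerm d A)`;
* `two_le_of_presContext`, `squarefree_monicGerm_of_presContext` — the two inputs from the context hypothesis;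
* **`finite_primes_of_presContext`**, **`finite_graphData_of_presContext`**, **`finite_graphData_swap_of_presContext`** — the three finite
  index sets of the budget, under the context hypothesis verbatim (`k` perfect of characteristic `p`; `[IsAlgClosed k]` suffices).
-/

set_option linter.dupNamespace false -- mandated namespace of this single-conjunct summit

noncomputable section

namespace Summit.ResolutionOfSingularities.ResolutionOfSingularities.Theorems

namespace NCBranchPrimes

open MvPowerSeries PolyDescent MonicDescent WildMonic NCPoly TameFourTupleDrop Literature.AlgebraicGeometry.Resolution

variable {k : Type} [Field k]

/-! ## `f · ∏ X_l` is squarefree -/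

/-- Distinct variables do not divide each other. -/
theorem not_X_dvd_X {n : ℕ} {a l : Fin n} (hal : a ≠ l) : ¬ (X a : MvPowerSeries (Fin n) k) ∣ X l := by
  intro h
  have h1 := (X_dvd_iff.mp h) (Finsupp.single l 1) (by rw [Finsupp.single_eq_of_ne hal])
  rw [coeff_X, if_pos rfl] at h1
  exact one_ne_zero h1

/-- `f · ∏_{l ∈ S} X_l` is squarefree when `f` is squarefree and no `X_l`, `l ∈ S`, divides `f`. -/
theorem squarefree_mul_prod_X {n : ℕ} {f : MvPowerSeries (Fin n) k} (hf : Squarefree f) (S : Finset (Fin n))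
    (hS : ∀ l ∈ S, ¬ (X l : MvPowerSeries (Fin n) k) ∣ f) : Squarefree (f * ∏ l ∈ S, (X l : MvPowerSeries (Fin n) k)) := by
  classical
  haveI := TameFourTupleDrop.uniqueFactorizationMonoid_mvPowerSeries (k := k) n
  induction S using Finset.induction_on with
  | empty => rwa [Finset.prod_empty, mul_one]
  | insert a S haS ih =>
    have hS' : ∀ l ∈ S, ¬ (X l : MvPowerSeries (Fin n) k) ∣ f := fun l hl => hS l (Finset.mem_insert_of_mem hl)
    have h1 : f * ∏ l ∈ insert a S, (X l : MvPowerSeries (Fin n) k) = X a * (f * ∏ l ∈ S, (X l : MvPowerSeries (Fin n) k)) := by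
      rw [Finset.prod_insert haS]
      ring
    rw [h1, squarefree_mul_iff]
    refine ⟨(TrackC.prime_X a).irreducible.isRelPrime_iff_not_dvd.mpr ?_, (TrackC.prime_X a).squarefree, ih hS'⟩
    intro hdvd
    rcases (TrackC.prime_X a).dvd_or_dvd hdvd with h2 | h2
    · exact hS a (Finset.mem_insert_self a S) h2
    · obtain ⟨l, hl, hal⟩ := (TrackC.prime_X (k := k) a).exists_mem_finset_dvd h2
      exact not_X_dvd_X (fun h => haS (by rw [h]; exact hl)) hal

/-! ## Legal coordinate changes preserve squarefreeness -/

/-- The coordinate change of a count move preserves squarefreeness. -/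
theorem squarefree_subst_of_isCountMove {Φ : Fin 3 → MvPowerSeries (Fin 3) k} {w : Fin 3 → ℕ} (hΦ : IsCountMove Φ w)
    {g : MvPowerSeries (Fin 3) k} (hg : Squarefree g) : Squarefree (subst Φ g) := by
  have h0 : ∀ i, constantCoeff (Φ i) = 0 := hΦ.1
  have hdet : IsUnit (FormalCoordChange.linMat Φ).det := hΦ.2.1
  obtain ⟨τ, hτσ, hστ⟩ := exists_inverse_ringHom h0 hdet
  have hS : HasSubst Φ := hasSubst_of_constantCoeff_zero h0
  have h1 := squarefree_map_of_inverse (substAlgHom hS).toRingHom τ (fun x => by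
    change τ ((substAlgHom hS) x) = x
    rw [coe_substAlgHom hS]
    exact hτσ x) (fun x => by
    change (substAlgHom hS) (τ x) = x
    rw [coe_substAlgHom hS]
    exact hστ x) hg
  change Squarefree ((substAlgHom hS) g) at h1
  rwa [coe_substAlgHom hS] at h1

/-! ## A presented regime label has a squarefree germ -/

/-- **A PRESENTED LABEL HAS A SQUAREFREE MONIC GERM.**  If the admissible decoration `δ` (squarefree strict transform `δ.f`, no boundary
letter dividing it) is presented by the label `A` in the legal coordinates `Θ` (`Θ^*(δ.f · ∏_{l ∈ O} X_l) = U · monicGerm d A`, `U(0) ≠ 0`),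
then `monicGerm d A` is squarefree. -/
theorem squarefree_monicGerm_of_presBy {b : MvPowerSeries (Fin (2 + 1)) k} {δ : Decoration k 2} {d : ℕ} {A : Fin d → MvPowerSeries (Fin 2) k}
    {N : Finset (Fin 2)} {Θ : Fin (2 + 1) → MvPowerSeries (Fin (2 + 1)) k} (hadm : Admissible b δ) (hpres : δ.PresBy d A N Θ) :
    Squarefree (NCPoly.monicGerm d A) := by
  obtain ⟨U, -, hΘ⟩ := hpres.2.2.2.2
  have hsqf : Squarefree (δ.f * ∏ l ∈ δ.O, (X l : MvPowerSeries (Fin (2 + 1)) k)) :=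
    squarefree_mul_prod_X hadm.2.1 δ.O fun l hl => hadm.2.2 l (δ.O_subset hl)
  have h1 : Squarefree (subst Θ (δ.f * ∏ l ∈ δ.O, (X l : MvPowerSeries (Fin (2 + 1)) k))) :=
    squarefree_subst_of_isCountMove hpres.1.1 hsqf
  rw [hΘ] at h1
  exact h1.squarefree_of_dvd (dvd_mul_left _ U)

/-! ## Under the context hypothesis of the budget laws -/

/-- The context hypothesis gives `2 ≤ d`. -/
theorem two_le_of_presContext {d : ℕ} {A : Fin d → MvPowerSeries (Fin 2) k} {N : Finset (Fin 2)}
    (hctx : ∃ (b : MvPowerSeries (Fin (2 + 1)) k) (δ : Decoration k 2) (Θ : Fin (2 + 1) → MvPowerSeries (Fin (2 + 1)) k),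
      Admissible b δ ∧ 2 ≤ δ.o ∧ δ.c = d ∧ δ.PresBy d A N Θ) : 2 ≤ d := by
  obtain ⟨b, δ, Θ, -, ho, hc, -⟩ := hctx
  rw [← hc, Decoration.c]
  omega

/-- The context hypothesis gives a squarefree germ. -/
theorem squarefree_monicGerm_of_presContext {d : ℕ} {A : Fin d → MvPowerSeries (Fin 2) k} {N : Finset (Fin 2)}
    (hctx : ∃ (b : MvPowerSeries (Fin (2 + 1)) k) (δ : Decoration k 2) (Θ : Fin (2 + 1) → MvPowerSeries (Fin (2 + 1)) k),
      Admissible b δ ∧ 2 ≤ δ.o ∧ δ.c = d ∧ δ.PresBy d A N Θ) : Squarefree (NCPoly.monicGerm d A) := by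
  obtain ⟨b, δ, Θ, hadm, -, -, hpres⟩ := hctx
  exact squarefree_monicGerm_of_presBy hadm hpres

/-- **FINITE PRIME INDEX SET UNDER THE CONTEXT**: finitely many non-maximal primes `P` with `monicGerm d A ∈ P^d`. -/
theorem finite_primes_of_presContext (p : ℕ) [Fact p.Prime] [CharP k p] [PerfectRing k p] {d : ℕ} {A : Fin d → MvPowerSeries (Fin 2) k}
    {N : Finset (Fin 2)}
    (hctx : ∃ (b : MvPowerSeries (Fin (2 + 1)) k) (δ : Decoration k 2) (Θ : Fin (2 + 1) → MvPowerSeries (Fin (2 + 1)) k),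
      Admissible b δ ∧ 2 ≤ δ.o ∧ δ.c = d ∧ δ.PresBy d A N Θ) :
    Set.Finite {P : Ideal (MvPowerSeries (Fin 3) k) | P.IsPrime ∧ P ≠ IsLocalRing.maximalIdeal (MvPowerSeries (Fin 3) k) ∧
      NCPoly.monicGerm d A ∈ P ^ d} :=
  finite_primes_of_monicGerm_mem_pow p (two_le_of_presContext hctx) A (squarefree_monicGerm_of_presContext hctx)

/-- **FINITELY MANY u₁-GRAPH DATA UNDER THE CONTEXT.** -/
theorem finite_graphData_of_presContext (p : ℕ) [Fact p.Prime] [CharP k p] [PerfectRing k p] {d : ℕ} {A : Fin d → MvPowerSeries (Fin 2) k}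
    {N : Finset (Fin 2)}
    (hctx : ∃ (b : MvPowerSeries (Fin (2 + 1)) k) (δ : Decoration k 2) (Θ : Fin (2 + 1) → MvPowerSeries (Fin (2 + 1)) k),
      Admissible b δ ∧ 2 ≤ δ.o ∧ δ.c = d ∧ δ.PresBy d A N Θ) :
    Set.Finite {h : MvPowerSeries (Fin 2) k | (∀ e : Fin 2 →₀ ℕ, e 1 ≠ 0 → coeff e h = 0) ∧
      ∃ ψ : MvPowerSeries (Fin 2) k, constantCoeff ψ = 0 ∧ IsPermissibleTwoT d (shift d (shearT h A) ψ)} :=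
  finite_graphData p (two_le_of_presContext hctx) A (squarefree_monicGerm_of_presContext hctx)

/-- **FINITELY MANY u₂-GRAPH DATA UNDER THE CONTEXT** (u₁-graph data of the swapped label `j ↦ A_j(u₂,u₁)`). -/
theorem finite_graphData_swap_of_presContext (p : ℕ) [Fact p.Prime] [CharP k p] [PerfectRing k p] {d : ℕ}
    {A : Fin d → MvPowerSeries (Fin 2) k} {N : Finset (Fin 2)}
    (hctx : ∃ (b : MvPowerSeries (Fin (2 + 1)) k) (δ : Decoration k 2) (Θ : Fin (2 + 1) → MvPowerSeries (Fin (2 + 1)) k),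
      Admissible b δ ∧ 2 ≤ δ.o ∧ δ.c = d ∧ δ.PresBy d A N Θ) :
    Set.Finite {g : MvPowerSeries (Fin 2) k | (∀ e : Fin 2 →₀ ℕ, e 1 ≠ 0 → coeff e g = 0) ∧
      ∃ ψ : MvPowerSeries (Fin 2) k, constantCoeff ψ = 0 ∧
        IsPermissibleTwoT d (shift d (shearT g (fun j => subst (![X 1, X 0] : Fin 2 → MvPowerSeries (Fin 2) k) (A j))) ψ)} :=
  finite_graphData_swap p (two_le_of_presContext hctx) A (squarefree_monicGerm_of_presContext hctx)

end NCBranchPrimes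

end Summit.ResolutionOfSingularities.ResolutionOfSingularities.Theorems

end
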